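import Summits.RiemannHypothesis.RiemannHypothesis.Theorems.Splittings.BombieriTruncPairing

/-!
# Splittings — x-wuc (xiv-a3): the SCREENING PRINCIPLE (K2) and the PENCIL form (K3) of Bombieri's question B′

Cell rh-split, seat rh-split-x-wuc g5 (brief sha16 f79c5f09d8bcb036), card `run/shared/lean/pub/rh-split/cards/SPLIT-x-wuc.md` §11
(referee rh-split-ref g3 2026-08-27T06:23:10Z: REPLAY PASS of the scratch `HOME/rh-split-x-wuc/SplitXWucG5.lean`; lead RULING #35:
cut (xiv)).  Carved VERBATIM from that scratch (file of record sha16 66b013c38c58c722); sections as numbered there.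
* §4 `pairing` (`⟨x, P y⟩`), `GramPosDef`, (K2) `exists_negRoot_of_screening` (a `c`-cheap vector forces a real root in `(−c,0)`;
  IVT on the pencil `G + tP` minimised over the unit sphere) and its converse `screening_of_negRoot`; `not_boundedAway_of_screening`;
* §8 (K3) `PencilNonneg`, `pencilNonneg_iff_boundedAway : PENCIL(E) ⟺ B′(E)` under Gram positivity.  UNCONDITIONAL instrument facts
  (for the S-C5 engines: `|μ*_N| = sup{c : G_N + c·P_N ⪰ 0}` is a Hermitian definiteness threshold).
HONEST LABEL: «SPLITTING SEARCH over kernel-typed RH-EQUIVALENCES; a splitting A ∧ B ⟹ RH is CONDITIONAL bookkeeping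
unless A and B are both proved; nothing here bears on the truth of RH.»
-/

set_option linter.dupNamespace false

noncomputable section

open scoped Classical ComplexConjugate
open Set Filter Topology Complex MeasureTheory

namespace Summit.RiemannHypothesis.RiemannHypothesis.Theorems.Splittings.BombieriTruncScreening

open Literature.NumberTheory.LFunctions Literature.NumberTheory.LFunctions.Bombieri2000
open Summit.RiemannHypothesis.RiemannHypothesis.Theses.RuelleBand
open Summit.RiemannHypothesis.RiemannHypothesis.Theorems.Splittings.BombieriTruncEigen
open Summit.RiemannHypothesis.RiemannHypothesis.Theorems.Splittings.BombieriFozNoDep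
open Summit.RiemannHypothesis.RiemannHypothesis.Theorems.Splittings.BombieriTruncGram
open Summit.RiemannHypothesis.RiemannHypothesis.Theorems.Splittings.BombieriTruncPairing

variable {E : Set ℝ} {N : ℕ}

/-! ## §4 (K2) The SCREENING PRINCIPLE (Gram positivity in hypothesis position) -/

/-- Positive definiteness of the Gram form on `Γ_N`: the exponentials `e_γ`, `γ ∈ Γ_N`, are linearly independent
in `L²(E)` — automatic when the `γ`'s of `Γ_N` are pairwise distinct (simple zeros) and `|E| > 0`. -/
def GramPosDef (E : Set ℝ) (N : ℕ) : Prop :=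
  ∀ x : truncIdx N → ℂ, x ≠ 0 → 0 < ∫ u in E, ‖F N x u‖ ^ 2

/-- **(K2) the screening criterion (kernel).** If the Gram form is positive definite on `Γ_N` and some test vector
is CHEAP — `‖F_x‖²_{L²(E)} < c · (−Re Σ x̄_γ x_{γ̄})` — then `𝒦_E(Γ_N)` has a real eigenvalue in `(−c, 0)`.
Proof: the least value `m(t)` of the Hermitian pencil `Re⟨(G + tP)w, w⟩` on the unit sphere is `1`-Lipschitz in `t`,
`m(0) > 0 > m(c)`; at a zero `t₀ ∈ (0, c)` the minimiser `v` has `(G + t₀P)v = 0` (polarisation), i.e.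
`𝒦 v = P G v = −t₀ v`. [new-in-kernel; the variational principle behind Bombieri2000Weil §9 Lemma 12 / Thm 9] -/
theorem exists_negRoot_of_screening {a : ℝ} (hE : E ⊆ Icc (-a) a) (hG : GramPosDef E N) {c : ℝ}
    (hc : 0 < c) {x : truncIdx N → ℂ} (hx : ∫ u in E, ‖F N x u‖ ^ 2 < c * -(pairing N x x).re) :
    ∃ μ ∈ (truncKMat E N).charpoly.roots, μ.im = 0 ∧ -c < μ.re ∧ μ.re < 0 := by
  -- the pencil of quadratic forms
  set q : ℝ → (truncIdx N → ℂ) → ℝ := fun t w ↦ (gram E N w w).re + t * (pairing N w w).re with hqdef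
  have hq_cont : ∀ t, Continuous (q t) := by
    intro t
    simp only [hqdef, gram, pairing]
    fun_prop
  have hq_smul : ∀ t (r : ℝ) w, q t ((r : ℂ) • w) = r ^ 2 * q t w := by
    intro t r w
    simp only [hqdef, gram_real_smul, pairing_real_smul, Complex.re_ofReal_mul]
    ring
  -- the unit sphere is compact
  set S : Set (truncIdx N → ℂ) := {w | ∑ j, ‖w j‖ ^ 2 = 1} with hSdef
  have hnormsq_cont : Continuous fun w : truncIdx N → ℂ ↦ ∑ j, ‖w j‖ ^ 2 := by fun_prop
  have hS : IsCompact S := by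
    refine Metric.isCompact_of_isClosed_isBounded (isClosed_eq hnormsq_cont continuous_const) ?_
    refine (Metric.isBounded_closedBall (x := (0 : truncIdx N → ℂ)) (r := 1)).subset fun w hw ↦ ?_
    rw [mem_closedBall_zero_iff, pi_norm_le_iff_of_nonneg zero_le_one]
    intro j
    have hw' : ∑ j, ‖w j‖ ^ 2 = 1 := hw
    have h1 : ‖w j‖ ^ 2 ≤ 1 := by
      rw [← hw']
      exact Finset.single_le_sum (f := fun j ↦ ‖w j‖ ^ 2) (fun i _ ↦ by positivity) (Finset.mem_univ j)
    nlinarith [norm_nonneg (w j)]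
  have hx0 : x ≠ 0 := by
    rintro rfl
    simp at hx
  obtain ⟨r, hr, hrS⟩ := exists_unit_smul hx0
  have hSne : S.Nonempty := ⟨_, hrS⟩
  -- minimisers of each form on the sphere, and the least value m(t)
  have hmin : ∀ t : ℝ, ∃ z ∈ S, IsMinOn (q t) S z := fun t ↦ hS.exists_isMinOn hSne (hq_cont t).continuousOn
  choose z hzS hzmin using hmin
  set m : ℝ → ℝ := fun t ↦ q t (z t) with hmdef
  have hpS : ∀ w ∈ S, |(pairing N w w).re| ≤ 1 := fun w hw ↦ (abs_pairing_self_re_le w).trans (le_of_eq hw)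
  have hm_lip : LipschitzWith 1 m := by
    refine LipschitzWith.of_le_add fun t s ↦ ?_
    have h1 : m t ≤ q t (z s) := hzmin t (hzS s)
    have h2 : q t (z s) = m s + (t - s) * (pairing N (z s) (z s)).re := by
      simp only [hmdef, hqdef]; ring
    have h3 : (t - s) * (pairing N (z s) (z s)).re ≤ dist t s := by
      rw [Real.dist_eq]
      have h4 := hpS (z s) (hzS s)
      calc (t - s) * (pairing N (z s) (z s)).re ≤ |(t - s) * (pairing N (z s) (z s)).re| := le_abs_self _
        _ = |t - s| * |(pairing N (z s) (z s)).re| := abs_mul _ _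
        _ ≤ |t - s| * 1 := mul_le_mul_of_nonneg_left h4 (abs_nonneg _)
        _ = |t - s| := mul_one _
    linarith
  have hm_cont : Continuous m := hm_lip.continuous
  -- signs at the endpoints
  have hm0 : 0 < m 0 := by
    have hz0 : z 0 ≠ 0 := by
      intro h
      have h' : ∑ j, ‖z 0 j‖ ^ 2 = 1 := hzS 0
      rw [h] at h'
      simp at h'
    have h1 : m 0 = ∫ u in E, ‖F N (z 0) u‖ ^ 2 := by
      simp only [hmdef, hqdef, zero_mul, add_zero, gram_self_re hE]
    rw [h1]
    exact hG _ hz0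
  have hmc : m c < 0 := by
    have h1 : m c ≤ q c ((r : ℂ) • x) := hzmin c hrS
    have h2 : q c ((r : ℂ) • x) = r ^ 2 * q c x := hq_smul c r x
    have h3 : q c x < 0 := by
      simp only [hqdef, gram_self_re hE]
      linarith
    have h4 : r ^ 2 * q c x < 0 := mul_neg_of_pos_of_neg (pow_pos hr 2) h3
    linarith
  -- intermediate value theorem
  obtain ⟨t₀, ht₀I, ht₀⟩ : ∃ t₀ ∈ Icc (0 : ℝ) c, m t₀ = 0 :=
    intermediate_value_Icc' hc.le hm_cont.continuousOn ⟨hmc.le, hm0.le⟩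
  have ht₀0 : 0 < t₀ := by
    rcases eq_or_lt_of_le ht₀I.1 with h | h
    · rw [← h] at ht₀; linarith
    · exact h
  have ht₀c : t₀ < c := by
    rcases eq_or_lt_of_le ht₀I.2 with h | h
    · rw [h] at ht₀; linarith
    · exact h
  -- the minimiser at t₀
  set v := z t₀ with hvdef
  have hvS : ∑ j, ‖v j‖ ^ 2 = 1 := hzS t₀
  have hv0 : v ≠ 0 := by
    intro h
    rw [h] at hvS
    simp at hvS
  have hqv : q t₀ v = 0 := ht₀
  have hnonneg : ∀ w, 0 ≤ q t₀ w := by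
    intro w
    by_cases hw : w = 0
    · subst hw
      simp [hqdef]
    obtain ⟨ρ, hρ, hρS⟩ := exists_unit_smul hw
    have h1 : 0 ≤ q t₀ ((ρ : ℂ) • w) := by rw [← hqv]; exact hzmin t₀ hρS
    rw [hq_smul] at h1
    by_contra hneg
    push Not at hneg
    nlinarith [pow_pos hρ 2]
  -- the pencil sesquilinear form at t₀ and its polarisation
  set Bf : (truncIdx N → ℂ) → (truncIdx N → ℂ) → ℂ :=
    fun w₁ w₂ ↦ gram E N w₁ w₂ + (t₀ : ℂ) * pairing N w₁ w₂ with hBf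
  have hBq : ∀ w, (Bf w w).re = q t₀ w := by
    intro w
    simp only [hBf, hqdef, Complex.add_re, Complex.re_ofReal_mul]
  have hBconj : ∀ w₁ w₂, conj (Bf w₂ w₁) = Bf w₁ w₂ := by
    intro w₁ w₂
    simp only [hBf, map_add, map_mul, Complex.conj_ofReal, conj_gram, conj_pairing]
  have hBadd_left : ∀ w₁ w₂ w₃, Bf (w₁ + w₂) w₃ = Bf w₁ w₃ + Bf w₂ w₃ := by
    intro w₁ w₂ w₃
    simp only [hBf, gram_add_left, pairing_add_left]
    ring
  have hBadd_right : ∀ w₁ w₂ w₃, Bf w₁ (w₂ + w₃) = Bf w₁ w₂ + Bf w₁ w₃ := by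
    intro w₁ w₂ w₃
    simp only [hBf, gram_add_right, pairing_add_right]
    ring
  have hBsmul_left : ∀ (κ : ℂ) w₁ w₂, Bf (κ • w₁) w₂ = conj κ * Bf w₁ w₂ := by
    intro κ w₁ w₂
    simp only [hBf, gram_smul_left, pairing_smul_left]
    ring
  have hBsmul_right : ∀ (κ : ℂ) w₁ w₂, Bf w₁ (κ • w₂) = κ * Bf w₁ w₂ := by
    intro κ w₁ w₂
    simp only [hBf, gram_smul_right, pairing_smul_right]
    ring
  have hRe : ∀ w, (Bf v w).re = 0 := by
    intro w
    set R := (Bf v w).re with hR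
    set C := (Bf w w).re with hC
    have hC0 : 0 ≤ C := by rw [hC, hBq]; exact hnonneg w
    have hvv : (Bf v v).re = 0 := by rw [hBq]; exact hqv
    have hwv : (Bf w v).re = R := by rw [hR, ← hBconj v w, Complex.conj_re]
    have key : ∀ s : ℝ, 0 ≤ 2 * s * R + s ^ 2 * C := by
      intro s
      have h := hnonneg (v + (s : ℂ) • w)
      rw [← hBq] at h
      have hexp : Bf (v + (s : ℂ) • w) (v + (s : ℂ) • w) =
          Bf v v + (s : ℂ) * Bf v w + ((s : ℂ) * Bf w v + (s : ℂ) * ((s : ℂ) * Bf w w)) := by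
        rw [hBadd_left, hBadd_right, hBadd_right, hBsmul_right, hBsmul_left, hBsmul_left, hBsmul_right,
          Complex.conj_ofReal]
      rw [hexp] at h
      simp only [Complex.add_re, Complex.re_ofReal_mul, hvv, hwv] at h
      nlinarith [h]
    by_contra hR0
    have hR2 : 0 < R ^ 2 := by positivity
    have hC1 : 0 < C + 1 := by linarith
    have h := key (-R / (C + 1))
    have h' : 2 * (-R / (C + 1)) * R + (-R / (C + 1)) ^ 2 * C = -(R ^ 2 * (C + 2) / (C + 1) ^ 2) := by
      field_simp
      ring
    rw [h'] at h
    have h'' : 0 < R ^ 2 * (C + 2) / (C + 1) ^ 2 := by positivity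
    linarith
  have hB0 : ∀ w, Bf v w = 0 := by
    intro w
    apply Complex.ext
    · simpa using hRe w
    · have h := hRe (I • w)
      rw [hBsmul_right, Complex.mul_re, Complex.I_re, Complex.I_im, zero_mul, one_mul, zero_sub] at h
      simp only [Complex.zero_im]
      linarith
  -- read off `G v = −t₀ P v` row by row with `w = e_i`
  have hrowG : ∀ i : truncIdx N,
      ∑ l : truncIdx N, KE E (conj ((i : ZeroIdx).gamma)) ((l : ZeroIdx).gamma) * v l =
        -(t₀ : ℂ) * v (tbar i) := by
    intro i
    have h := hB0 (Pi.single i 1)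
    rw [← hBconj] at h
    have hg : gram E N (Pi.single i 1) v =
        ∑ l : truncIdx N, KE E (conj ((i : ZeroIdx).gamma)) ((l : ZeroIdx).gamma) * v l := by
      rw [gram, Finset.sum_eq_single i (fun j _ hj ↦ by simp [hj]) (by simp)]
      exact Finset.sum_congr rfl fun l _ ↦ by simp; ring
    have hp : pairing N (Pi.single i 1) v = v (tbar i) := by
      rw [pairing, Finset.sum_eq_single i (fun j _ hj ↦ by simp [hj]) (by simp)]
      simp
    have h2 : Bf (Pi.single i 1) v = 0 := by
      rw [← map_zero conj, ← h, Complex.conj_conj]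
    simp only [hBf, hg, hp] at h2
    linear_combination h2
  -- hence `𝒦 v = −t₀ v`
  have hK : (truncKMat E N).mulVec v = ((-t₀ : ℝ) : ℂ) • v := by
    funext l
    have h := hrowG (tbar l)
    rw [gamma_tbar, Complex.conj_conj, tbar_tbar] at h
    simp only [Pi.smul_apply, smul_eq_mul, Complex.ofReal_neg]
    simpa [Matrix.mulVec, dotProduct, truncKMat, KMat] using h
  refine ⟨((-t₀ : ℝ) : ℂ), Literature.Analysis.InnerProduct.mem_roots_charpoly_of_mulVec_eq_smul hv0 hK,
    Complex.ofReal_im _, ?_, ?_⟩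
  · rw [Complex.ofReal_re]; linarith
  · rw [Complex.ofReal_re]; linarith

/-- The easy half of the variational principle: an eigenvalue in `(−c, 0)` GIVES a cheap vector (its eigenvector),
when the Gram form is positive definite. So `B′` at level `N` with constant `c` ⟺ no `c`-cheap vector. -/
theorem screening_of_negRoot {a : ℝ} (hE : E ⊆ Icc (-a) a) (hG : GramPosDef E N) {c : ℝ} {μ : ℂ}
    (hμ : μ ∈ (truncKMat E N).charpoly.roots) (him : μ.im = 0) (hlo : -c < μ.re) (hhi : μ.re < 0) :
    ∃ x : truncIdx N → ℂ, ∫ u in E, ‖F N x u‖ ^ 2 < c * -(pairing N x x).re := by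
  obtain ⟨v, hv0, hv⟩ := Literature.Analysis.InnerProduct.exists_mulVec_eq_smul_of_mem_roots_charpoly hμ
  refine ⟨v, ?_⟩
  have h1 : gram E N v v = μ * pairing N v v := gram_eigvec hv v
  have h2 : ∫ u in E, ‖F N v u‖ ^ 2 = μ.re * (pairing N v v).re := by
    rw [← gram_self_re hE, h1, Complex.mul_re, him, zero_mul, sub_zero]
  have h3 : 0 < ∫ u in E, ‖F N v u‖ ^ 2 := hG v hv0
  have h4 : (pairing N v v).re < 0 := by
    by_contra h
    push Not at h
    rw [h2] at h3
    nlinarith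
  rw [h2]
  nlinarith

/-- **Screening kills `B′`.** If on the window `E` the Gram forms are eventually positive definite and for every
`c > 0` all large levels carry a `c`-cheap vector, then `¬ B′(E)`. [new-in-kernel; the finite-matrix half of the
screening theorem of card §11] -/
theorem not_boundedAway_of_screening {a : ℝ} (hE : E ⊆ Icc (-a) a) (hG : ∀ᶠ N in atTop, GramPosDef E N)
    (hscreen : ∀ c : ℝ, 0 < c → ∀ᶠ N in atTop, ∃ x : truncIdx N → ℂ,
      ∫ u in E, ‖F N x u‖ ^ 2 < c * -(pairing N x x).re) :
    ¬ TruncNegEigenvalueBoundedAway E := by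
  rintro ⟨c, hc, N₀, hN₀⟩
  obtain ⟨N, ⟨hGN, x, hx⟩, hNN₀⟩ := ((hG.and (hscreen c hc)).and (eventually_ge_atTop N₀)).exists
  obtain ⟨μ, hμ, him, hlo, hhi⟩ := exists_negRoot_of_screening hE hGN hc hx
  have := hN₀ N hNN₀ μ hμ him hhi
  linarith

/-! ## §8 (K3) `B′` as a semidefinite condition on explicit finite matrices: the PENCIL form

`B′(E) ⟺ PENCIL(E)`: for some fixed `c > 0` and all large `N` the Hermitian pencil `G_N + c·P_N` (Gram form of
the truncation plus `c` times the real pairing form `x ↦ Re Σ_j x̄_j x_{j̄}`) is positive semidefinite. Both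
directions are (K2) and its converse. So the `B′`-partner of rows C5/C18/X-5s is a statement about the INERTIA of
explicit `|Γ_N| × |Γ_N|` Hermitian matrices built from `∫_E e^{i(γ̄_j − γ_k)u} du` — no spectrum of a non-normal
matrix involved. [new reformulation] -/

/-- **PENCIL(E).** `∃ c > 0`, eventually in `N`: `‖F_x‖²_{L²(E)} + c · Re⟨x, P x⟩ ≥ 0` for every coefficient vector
`x` on `Γ_N`. [new conjecture-shaped def; rh-split x-wuc g5] -/
@[conjecture] def PencilNonneg (E : Set ℝ) : Prop :=
  ∃ c : ℝ, 0 < c ∧ ∃ N₀ : ℕ, ∀ N ≥ N₀, ∀ x : truncIdx N → ℂ,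
    0 ≤ (∫ u in E, ‖F N x u‖ ^ 2) + c * (pairing N x x).re

/-- **(K3)** On a bounded window with positive definite Gram forms, `PENCIL(E) ⟺ B′(E)`. [new] -/
theorem pencilNonneg_iff_boundedAway {a : ℝ} (hE : E ⊆ Icc (-a) a) (hG : ∀ N, GramPosDef E N) :
    PencilNonneg E ↔ TruncNegEigenvalueBoundedAway E := by
  constructor
  · rintro ⟨c, hc, N₀, h⟩
    refine ⟨c, hc, N₀, fun N hN μ hμ him hneg ↦ ?_⟩
    by_contra hlt
    push Not at hlt
    obtain ⟨x, hx⟩ := screening_of_negRoot hE (hG N) hμ him hlt hneg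
    have := h N hN x
    linarith
  · rintro ⟨c, hc, N₀, h⟩
    refine ⟨c, hc, N₀, fun N hN x ↦ ?_⟩
    by_contra hlt
    push Not at hlt
    have hx : ∫ u in E, ‖F N x u‖ ^ 2 < c * -(pairing N x x).re := by linarith
    obtain ⟨μ, hμ, him, hlo, hhi⟩ := exists_negRoot_of_screening hE (hG N) hc hx
    have := h N hN μ hμ him hhi
    linarith

end Summit.RiemannHypothesis.RiemannHypothesis.Theorems.Splittings.BombieriTruncScreening
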